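import Summits.BirchSwinnertonDyer.BirchSwinnertonDyer.Theorems.ErratumRoadFiveNonSurjCornerOfItemsR25
import HarnessLib

/-!
# BC3 skeleton — crux `NonSurjCorner` (item stmt-BirchSwinnertonDyer-19065; K2 `ErratumRoadFive` rank 6) — line `Lines/hybrid.lean`,
# CANDIDATE r26 (seat `bsd-stepL-corner-p1` g20; over the REGISTERED r24′ b5e15a83078c7b67; planner RULING 87 «r26 = ZERO STUBS GO»):
# ZERO stubs — `NonSurjCorner_of` proves the crux BY NAME from NINE ROUTE ITEMS BY NAME and nothing else

r26 vs r24′. r24′ registered FOUR stubs: slot 1′ `stub_deepWitness57` (∃-shaped deep witness) and slot 2″ `stub_twinLowerSupply57` (∃-shaped twin-lower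
supplies) — research-grade, beyond print —, slot 3 `stub_twinFactsFifteen57` (15 print names), slot 5 `stub_cornerShimuraFacts57` (2 + 4 print names).
RULINGS 72 ∕ 82 ∕ 83 (planner): print inputs are ITEMS BY NAME, never stubs. In r26 every r24′ stub is a route item bound by name or implied by route
items bound by name:
* slot 3 ≡ item 23048 `KatoTwinFactsFiveAnContra` (text-identical) — binder `hF`;
* slot 5 conjunct 1 ≡ item 27981 `EulerHalfGrossPrintFacts` — binder `hGr`; slot 5 conjunct 2 = conjunct 13 of item 19066 `PublishedInputsFive`
  (Friedberg–Hoffstein inert twist) ∧ item 19524 `ShimuraParametrizationDataNonempty` ∧ item 19716 `PastenComponentOrdersInput` ∧ the NEW aside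
  `ShimuraHeegnerEulerSystemInertPrintedIrr` (:= `Literature.NumberTheory.EllipticCurves.shimuraCurve_heegnerSystem_primitivesFromFiveIrr`, the printed CM-point
  primitives of `X_{N⁺,N⁻}` for IRREDUCIBLE `E[p]`; planner RULING 87, filed BY NAME) — binders `h₅ hJL hCO hPrim`;
* slot 1′ ⟸ items 23046 `NonSurjCornerKolyZDeep` ∧ 23047 `NonSurjCornerTwinMuAnDeep` (the gen-3 DEEP children of 19065) with conjuncts 5–7 of 23048
  (`deepWitness_of_kolyZShaAn_of_twinMuAnDeep`, g18) — binders `hZ hμ`;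
* slot 2″ ⟸ crux 19064 `X11aLowerHalf` with GZK ∕ modularity ∕ the two Friedberg–Hoffstein facts (`twinLowerSupply_of_x11aLowerHalf`, g18) — binder `h₃`.
Composition = `Theorems.nonSurjCorner_of_items_r25` (g20, p667178 ✓; = glue #26 p662125 with the two g18 derivations plugged in); the aside unfolds
definitionally to the Literature constant that theorem takes as its last argument. MONOTONE over r24′ (nothing is asked that the route file does not
declare). The ∃-shaped texts of r24′'s slots 1′ ∕ 2″ — WEAKER than 23046 ∧ 23047 resp. 19064 — stay in the tree as `@[conjecture]` constants
`Theorems.NonSurjCornerDeepWitnessResidual` ∕ `Theorems.NonSurjCornerTwinLowerSupplyResidual` (p668328 ✓) with the composition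
`Theorems.nonSurjCorner_of_residuals_of_items`; the unregistered OPTION r25b (`corner/g20/NonSurjCorner_hybrid_r25b_option.lean`) is the sharper-cone
alternative of record (RULING 87).

HONEST FRAMING: ZERO `sorry`; ONE theorem, `NonSurjCorner_of`, binding NINE registered route items BY NAME (23046, 23047, 23048, 19064, 19066, 27981, 19524,
19716, `ShimuraHeegnerEulerSystemInertPrintedIrr`) and concluding `Theses.ErratumRoadFive.NonSurjCorner` BY NAME: the crux is CLOSED MODULO ROUTE ITEMS, exactly
like 19715 (v17), 19109 (r24) and 21420 (r23). The research content of the corner is NOT reduced — it is the OPEN items 23046 (Kolyvagin's refined conjecture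
at a non-surjective irreducible image with `p ∥ N`), 23047 (Greenberg's μ = 0 at the deep pairs' Friedberg–Hoffstein twins) and 19064 (the rank-0 lower half
at multiplicative `p ≥ 5`, rung K6), plus cite-only print inputs; nothing is asserted about any curve (T7); BSD is proved for no curve. Published as a LINE
candidate (evidence); registering it is the planner's call (D-0145, RULING 87).

(r25, unregistered.) RULING-72 form with the primitives name as ONE cite stub. (r24′.) slot 6‴ PROVED (p660784), CT name supplied (glue #26). (r23.) slot 6″ ↦ (K).
(r22.) slot 6′ ↦ aux-prime supply. (r21.) slot 6 ↦ LAB′. (r20.) Euler twin input ∃-recut. (r19.) converse half ∃-recut. (r18.) μ-slot cut to (2a) ∧ (2b).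
-/

set_option linter.dupNamespace false
set_option autoImplicit false

namespace Summit.BirchSwinnertonDyer.BirchSwinnertonDyer.Cruxes.NonSurjCorner.Hybrid

open Summit.BirchSwinnertonDyer.BirchSwinnertonDyer.Theorems

/-! ## The composition (sorry-free): NINE route items BY NAME imply the crux, BY NAME — ZERO stubs -/

/-- **`NonSurjCorner_of`** — NINE route items BY NAME (23046 `NonSurjCornerKolyZDeep`, 23047 `NonSurjCornerTwinMuAnDeep`, 23048 `KatoTwinFactsFiveAnContra`,
19064 `X11aLowerHalf`, 19066 `PublishedInputsFive`, 27981 `EulerHalfGrossPrintFacts`, 19524 `ShimuraParametrizationDataNonempty`, 19716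
`PastenComponentOrdersInput`, aside `ShimuraHeegnerEulerSystemInertPrintedIrr`) imply the route decl `Theses.ErratumRoadFive.NonSurjCorner` BY NAME, via this
seat's landed composition `Theorems.nonSurjCorner_of_items_r25` (g20) = glue #26 (g19) ∘ {`deepWitness_of_kolyZShaAn_of_twinMuAnDeep`, `twinLowerSupply_of_x11aLowerHalf`}
(g18). No `sorry` anywhere in this file. -/
theorem NonSurjCorner_of
    (hZ : Summit.BirchSwinnertonDyer.BirchSwinnertonDyer.Theses.ErratumRoadFive.NonSurjCornerKolyZDeep)
    (hμ : Summit.BirchSwinnertonDyer.BirchSwinnertonDyer.Theses.ErratumRoadFive.NonSurjCornerTwinMuAnDeep)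
    (hF : Summit.BirchSwinnertonDyer.BirchSwinnertonDyer.Theses.ErratumRoadFive.KatoTwinFactsFiveAnContra)
    (h₃ : Summit.BirchSwinnertonDyer.BirchSwinnertonDyer.Theses.ErratumRoadFive.X11aLowerHalf)
    (h₅ : Summit.BirchSwinnertonDyer.BirchSwinnertonDyer.Theses.ErratumRoadFive.PublishedInputsFive)
    (hGr : Summit.BirchSwinnertonDyer.BirchSwinnertonDyer.Theses.ErratumRoadFive.EulerHalfGrossPrintFacts)
    (hJL : Summit.BirchSwinnertonDyer.BirchSwinnertonDyer.Theses.ErratumRoadFive.ShimuraParametrizationDataNonempty)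
    (hCO : Summit.BirchSwinnertonDyer.BirchSwinnertonDyer.Theses.ErratumRoadFive.PastenComponentOrdersInput)
    (hPrim : Summit.BirchSwinnertonDyer.BirchSwinnertonDyer.Theses.ErratumRoadFive.ShimuraHeegnerEulerSystemInertPrintedIrr) :
    Summit.BirchSwinnertonDyer.BirchSwinnertonDyer.Theses.ErratumRoadFive.NonSurjCorner :=
  nonSurjCorner_of_items_r25 hZ hμ hF h₃ h₅ hGr hJL hCO hPrim

end Summit.BirchSwinnertonDyer.BirchSwinnertonDyer.Cruxes.NonSurjCorner.Hybrid
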